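import Summits.ResolutionOfSingularities.ResolutionOfSingularities.Theorems.FrobeniusLadderFInjectiveMacaulayficationFInjectiveMacaulayficationDimFour
import Summits.ResolutionOfSingularities.ResolutionOfSingularities.Theorems.FrobeniusLadderFInjectiveMacaulayficationFTemkinClosedPoints
import Summits.ResolutionOfSingularities.ResolutionOfSingularities.Theorems.FrobeniusLadderFInjectiveMacaulayficationLocalFullificationDimFour
import HarnessLib

/-!
# ★ THE DIM-4 SLICE OF THE CRUX ⟸ Cossart–Piltant package ∧ (L4) — the headline of res-L1-w45a-plan-1 RULINGS R16.64–R16.66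
# (crux `FInjectiveMacaulayfication` stmt-ResolutionOfSingularities-15315, chain w45a; assembly of res-L1-w45a-stub-3's (ii)
# `FTemkinClosedPoints.exists_isBlowup_full_of_L4` (p584097; THEOREM A(4) p557070/p583229 + F-Temkin at the closed points) with res-L1-w45a-lead-1's
# (iii) `FInjectiveMacaulayficationDimFour.fiModel_integral_dimLe4_of_step` (p584445) and the statement (L4) `LocalFullificationDimFour` (p583849);
# seat res-L1-w45a-lead-1 g7)

[OURS · L1 W4.5a] Support file (`--supports stmt-ResolutionOfSingularities-15315 --as helper`); replaces the role of NO printed item; NOT a statement of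
the manuscript; def-free; THEOREM modulo `CossartPiltant2019General`, `Stacks081R`, `CossartPiltant2019Principalization` BY NAME and modulo the
CANDIDATE (L4) `LocalFullificationDimFour.LocalFullificationDimFour` of OURS; AI-written (AI review is weaker than expert review).

**`fiModel_integral_dimLe4_of_L4 (hG h081R hP) (hL4)`**: every integral separated `k`-variety `X` of dimension `≤ 4` (`char k = p`) has a proper
birational INTEGRAL model `X′ → X` all of whose local rings are FULL — domain ∧ systems of parameters weakly regular ∧ parameter ideals Frobenius
closed — i.e. the right-hand side of `Reductions.fInjectiveMacaulayfication_iff_integral` for `X`: **the crux `FInjectiveMacaulayfication` restricted to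
dimension ≤ 4 follows from the three printed theorems of the Cossart–Piltant package and the ONE local d = 4 statement (L4)** (FULL-ification of a
4-dimensional local blow-up scheme regular off its closed fibre by one `Sing`-supported blowing up; CM-half known, F-half open). `dim ≤ 3`: CP outright.
[folklore assembly; cite: CossartPiltant2019, Thm. 1.1; Prop. 4.4] [cite: RaynaudGruson1971, Thm. 5.2.2] [cite: Temkin2008, Prop. 2.3.4; Lemma 2.1.1]
-/

-- single-problem summit: the doubled namespace component is forced
set_option linter.dupNamespace false

noncomputable section

namespace Summit.ResolutionOfSingularities.ResolutionOfSingularities.Theorems.FInjectiveMacaulayfication.FInjectiveMacaulayficationDimFourOfL4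

open CategoryTheory CategoryTheory.Limits AlgebraicGeometry TopologicalSpace IsLocalRing
open Literature.AlgebraicGeometry.Resolution
open Summit.ResolutionOfSingularities.ResolutionOfSingularities.Theorems.FInjectiveMacaulayfication
open SliceableCentre FCUnguardedAprime

/-- **★ THE DIM-4 SLICE OF THE CRUX ⟸ CP package ∧ (L4)** (integral form = RHS of `Reductions.fInjectiveMacaulayfication_iff_integral` for every
`X` of dimension `≤ 4`). [OURS · conditional on the CANDIDATE (L4) and on CP 1.1 / R–G / CP 4.4 BY NAME]
[cite: CossartPiltant2019, Thm. 1.1; Prop. 4.4] [cite: Temkin2008, Prop. 2.3.4] -/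
theorem fiModel_integral_dimLe4_of_L4
    (hG : CossartPiltant2019General.{0}) (h081R : Stacks081R.{0}) (hP : CossartPiltant2019Principalization.{0})
    (hL4 : LocalFullificationDimFour.LocalFullificationDimFour)
    (p : ℕ) [hp : Fact p.Prime] (k : Type) [Field k] [CharP k p] (X : Scheme.{0}) (f : X ⟶ Spec (.of k))
    [IsSeparated f] [LocallyOfFiniteType f] [QuasiCompact f] [IsIntegral X] (h4 : topologicalKrullDim X ≤ 4) :
    ∃ (X' : Scheme.{0}) (π : X' ⟶ X), IsProper π ∧ IsBirational π ∧ IsIntegral X' ∧ ∀ x : X', FullCl p (X'.presheaf.stalk x) := by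
  by_cases h3 : topologicalKrullDim X ≤ 3
  · exact FInjectiveMacaulayficationDimFour.fiModel_integral_of_dim_le_three hG p k X f h3
  · -- `dim X = 4`
    have h4' : topologicalKrullDim X = 4 := by
      have h := h4
      induction hD : topologicalKrullDim X using WithBot.recBotCoe with
      | bot => rw [hD] at h3; exact absurd bot_le h3
      | coe a =>
        rw [hD] at h h3
        induction a using ENat.recTopCoe with
        | top => exact absurd (WithBot.coe_le_coe.mp h) (by simp)
        | coe n =>
          have hn : n ≤ 4 := by exact_mod_cast (WithBot.coe_le_coe.mp h)
          have hn' : ¬ n ≤ 3 := fun hle =>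
            h3 (WithBot.coe_le_coe.mpr (by exact_mod_cast hle : (n : ℕ∞) ≤ (3 : ℕ∞)))
          have : n = 4 := by omega
          subst this
          rfl
    haveI : IsLocallyNoetherian X := LocallyOfFiniteType.isLocallyNoetherian f
    obtain ⟨X'', f'', J'', hf'', hJ'', -, hfull⟩ :=
      FTemkinClosedPoints.exists_isBlowup_full_of_L4 (fun q hq => hL4 q hq) hG h081R hP p hp.out k X f h4'
    haveI : IsIntegral X'' := hf''.isIntegral hJ''
    exact ⟨X'', f'', hf''.isProper, hf''.isBirational' hJ'', inferInstance, hfull⟩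

end Summit.ResolutionOfSingularities.ResolutionOfSingularities.Theorems.FInjectiveMacaulayfication.FInjectiveMacaulayficationDimFourOfL4

end
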